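import Summits.KontsevichZagierPeriods.KontsevichZagierPeriods.Theorems.BetaCancellation.Negative.LoadBearing
import Literature.NumberTheory.Transcendental.KZMellinFibres
import Literature.NumberTheory.Transcendental.KZLogCalculusProofs
import Literature.NumberTheory.Transcendental.KZDominatedFamilyRelations

/-!
# `BetaCancellation` (stmt-KontsevichZagierPeriods-13633), line `dirichlet-companion-to-pi` — stub `stub_integrateOut`

Integrating out the monomial `y^{ℓ-1}` in the LAST coordinate of the box representation
`B = [(0,1)², x^{m-1}(1-x)^{-m} · y^{ℓ-1}]` INSIDE the Kontsevich–Zagier calculus of moves: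
`B ∼ R = [(0,1), ℓ⁻¹ · x^{m-1}(1-x)^{-m}]`, by

* ONE Newton–Leibniz move (rule (3), `KZ.newtonLeibnizRel`) in dimension `1 + 1` over the base
  `τ = (0,1)`, constant edges `a = 0 ≤ b = 1`, band `D = [(0,1) × [0,1], 𝟙_{box} · B.integrand]`
  and primitive `F(x,y) = ℓ⁻¹ x^{m-1}(1-x)^{-m} · y^ℓ`: on each fibre `y ↦ F(x,y)` is continuous on
  `[0,1]` (`ℓ > 0`), has derivative `x^{m-1}(1-x)^{-m} y^{ℓ-1} = B.integrand (x,y)` on `(0,1)`, and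
  `F(x,1) − F(x,0) = ℓ⁻¹ x^{m-1}(1-x)^{-m} = R.integrand x`; so `[D] − [R] ∈ relations`;
* the two null faces `{y = 0}`, `{y = 1}` of the band are dropped
  (`KZ.IntegralRep.of_sub_of_restrict_mem_relations`), and the restriction of `D` to the open box
  has the integrand of `B` (`KZ.of_sub_of_mem_relations_of_eqOn`).

Semialgebraicity of the primitive (rational exponents) is `KZ.isSemialgebraicFunOn_mellinIntegrand`
for the family `(X₀, 1 − X₀, X₁)` on the part `{y > 0}` of the band, glued with the constant `0` on
the face `{y = 0}` (`IsSemialgebraicFunOn.union`). Pattern of `KZ.IntegralRep.slab` /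
`KZ.IntegralRep.of_slab_sub_of_mem_newtonLeibnizRel` (primitive `t · f` there, `t^ℓ/ℓ · f` here).
No definitions; sorry-free; axioms ⊆ {propext, Classical.choice, Quot.sound}.

References: M. Kontsevich, D. Zagier, *Periods* (2001), §1.2 rule (3).
-/

noncomputable section

-- Summit.KontsevichZagierPeriods.KontsevichZagierPeriods.… is the tree's mandated layout (single-conjunct summit).
set_option linter.dupNamespace false

namespace Summit.KontsevichZagierPeriods.KontsevichZagierPeriods.BetaCancellationLine

open MeasureTheory Set
open Literature.NumberTheory.Transcendental
open Literature.NumberTheory.Transcendental.KZ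
open Literature.ModelTheory.ExponentialFields (IsSemialgebraic isSemialgebraic_setOf_eval_pos
  isSemialgebraic_setOf_eval_le isSemialgebraic_setOf_eval_lt)
open MvPolynomial (aeval X C)
open Summit.KontsevichZagierPeriods.KontsevichZagierPeriods.BetaCancellationNegative
  (volume_setOf_apply_eq_zero)

/-! ### §1 Coordinates on `ℝ² = ℝ¹ × ℝ` (`Fin.snoc`, `Fin.init`, `Fin.last`) -/

/-- `(x, t)₀ = x₀`. [folklore] -/
theorem intOut_snoc_zero (x : Fin 1 → ℝ) (t : ℝ) : (Fin.snoc x t : Fin 2 → ℝ) 0 = x 0 := by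
  rw [show (0 : Fin 2) = Fin.castSucc (0 : Fin 1) from rfl, Fin.snoc_castSucc]

/-- `(x, t)₁ = t`. [folklore] -/
theorem intOut_snoc_one (x : Fin 1 → ℝ) (t : ℝ) : (Fin.snoc x t : Fin 2 → ℝ) 1 = t := by
  rw [show (1 : Fin 2) = Fin.last 1 from rfl, Fin.snoc_last]

/-- `(init z)₀ = z₀`. [folklore] -/
theorem intOut_init_zero (z : Fin 2 → ℝ) : Fin.init z 0 = z 0 := rfl

/-- The last coordinate of `ℝ²` is the coordinate `1`. [folklore] -/
theorem intOut_last_one : (Fin.last 1 : Fin 2) = 1 := rfl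

/-! ### §2 The band `(0,1) × [0,1]` -/

/-- The band `(0,1) × [0,1] ⊆ ℝ²` is `ℚ`-semialgebraic. [folklore] -/
theorem intOut_isSemialgebraic_band :
    IsSemialgebraic ℚ {z : Fin 2 → ℝ | z 0 ∈ Ioo (0:ℝ) 1 ∧ 0 ≤ z 1 ∧ z 1 ≤ 1} := by
  have h1 := isSemialgebraic_setOf_eval_pos (k := ℚ) (R := ℝ) (X 0 : MvPolynomial (Fin 2) ℚ)
  have h2 := isSemialgebraic_setOf_eval_lt (k := ℚ) (R := ℝ) (X 0 : MvPolynomial (Fin 2) ℚ) 1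
  have h3 := isSemialgebraic_setOf_eval_le (k := ℚ) (R := ℝ) (0 : MvPolynomial (Fin 2) ℚ) (X 1)
  have h4 := isSemialgebraic_setOf_eval_le (k := ℚ) (R := ℝ) (X 1 : MvPolynomial (Fin 2) ℚ) 1
  convert ((h1.inter h2).inter h3).inter h4 using 1
  ext z
  simp [and_assoc]

/-- The band minus the open box lies in the two faces `{y = 0} ∪ {y = 1}`, hence is null.
[folklore] -/
theorem intOut_volume_band_diff_box :
    volume ({z : Fin 2 → ℝ | z 0 ∈ Ioo (0:ℝ) 1 ∧ 0 ≤ z 1 ∧ z 1 ≤ 1} \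
      {z : Fin 2 → ℝ | z 0 ∈ Ioo (0:ℝ) 1 ∧ z 1 ∈ Ioo (0:ℝ) 1}) = 0 := by
  refine measure_mono_null (fun z hz => ?_)
    (measure_union_null (volume_setOf_apply_eq_zero (1 : Fin 2) 0)
      (volume_setOf_apply_eq_zero (1 : Fin 2) 1))
  simp only [mem_sdiff, mem_setOf_eq, mem_Ioo, not_and, not_lt] at hz
  obtain ⟨⟨hz0, h0, h1⟩, h⟩ := hz
  simp only [mem_union, mem_setOf_eq]
  rcases h0.lt_or_eq with h0 | h0
  · exact Or.inr (le_antisymm h1 (h hz0 h0))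
  · exact Or.inl h0.symm

/-! ### §3 The primitive `ℓ⁻¹ x^{m-1}(1-x)^{-m} · y^ℓ` -/

/-- The primitive `F(x,y) = ℓ⁻¹ x^{m-1}(1-x)^{-m} y^ℓ` (`0 < ℓ`) is `ℚ`-semialgebraic on the band
`(0,1) × [0,1]`: on `{y > 0}` it is the Euler–Mellin integrand of the family `(X₀, 1 − X₀, X₁)` with
exponents `(m-1, -m, ℓ)` and constant `ℓ⁻¹` (`KZ.isSemialgebraicFunOn_mellinIntegrand`), on the face
`{y = 0}` it is `0`. [folklore] -/
theorem intOut_isSemialgebraicFunOn_prim {ℓ : ℚ} (hℓ : 0 < ℓ) (m : ℚ) :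
    IsSemialgebraicFunOn ℚ {z : Fin 2 → ℝ | z 0 ∈ Ioo (0:ℝ) 1 ∧ 0 ≤ z 1 ∧ z 1 ≤ 1}
      (fun z : Fin 2 → ℝ =>
        (ℓ:ℝ)⁻¹ * ((z 0) ^ ((m:ℝ) - 1) * (1 - z 0) ^ (-(m:ℝ))) * (z 1) ^ (ℓ:ℝ)) := by
  set I : Set (Fin 2 → ℝ) := {z | z 0 ∈ Ioo (0:ℝ) 1 ∧ 0 ≤ z 1 ∧ z 1 ≤ 1} with hI
  have hIs : IsSemialgebraic ℚ I := intOut_isSemialgebraic_band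
  have hPs : IsSemialgebraic ℚ (I ∩ {z | 0 < z 1}) := by
    refine hIs.inter ?_
    simpa using isSemialgebraic_setOf_eval_pos (k := ℚ) (R := ℝ) (X 1 : MvPolynomial (Fin 2) ℚ)
  have hpos : ∀ z ∈ I ∩ {z | 0 < z 1}, ∀ k : Fin 3,
      0 < aeval z ((![X 0, 1 - X 0, X 1] : Fin 3 → MvPolynomial (Fin 2) ℚ) k) := by
    rintro z ⟨⟨hz0, -, -⟩, hz1⟩ k
    have hz1' : 0 < z 1 := hz1
    fin_cases k <;> simp [hz0.1, hz0.2, hz1']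
  have hP : IsSemialgebraicFunOn ℚ (I ∩ {z | 0 < z 1}) (fun z : Fin 2 → ℝ =>
      (ℓ:ℝ)⁻¹ * ((z 0) ^ ((m:ℝ) - 1) * (1 - z 0) ^ (-(m:ℝ))) * (z 1) ^ (ℓ:ℝ)) := by
    refine (isSemialgebraicFunOn_mellinIntegrand hPs ![X 0, 1 - X 0, X 1] ![m - 1, -m, ℓ] ℓ⁻¹
      hpos).congr fun z _ => ?_
    simp only [mellinIntegrand_apply, Fin.prod_univ_three]
    simp only [Matrix.cons_val_zero, Matrix.cons_val_one, Matrix.cons_val, MvPolynomial.aeval_X,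
      map_sub, map_one, Rat.cast_inv, Rat.cast_sub, Rat.cast_one, Rat.cast_neg]
    ring
  have h0 : IsSemialgebraicFunOn ℚ (I \ (I ∩ {z | 0 < z 1})) (fun _ => (0:ℝ)) :=
    (isSemialgebraicFunOn_aeval (hIs.diff hPs) 0).congr fun x _ => by simp
  rw [← union_sdiff_cancel (inter_subset_left : I ∩ {z | 0 < z 1} ⊆ I)]
  refine IsSemialgebraicFunOn.union hP h0 (fun _ _ => rfl) fun z hz => ?_
  have hz1 : z 1 = 0 := by
    have h : ¬ 0 < z 1 := fun h => hz.2 ⟨hz.1, h⟩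
    have h' : 0 ≤ z 1 := hz.1.2.1
    exact le_antisymm (not_lt.1 h) h'
  have hℓ' : (ℓ:ℝ) ≠ 0 := by exact_mod_cast hℓ.ne'
  simp [hz1, Real.zero_rpow hℓ']

/-- On the open fibre: `d/dy (ℓ⁻¹ c y^ℓ) = c y^{ℓ-1}` for `0 < y` (`ℓ ≠ 0`). [folklore] -/
theorem intOut_hasDerivAt_prim {ℓ : ℚ} (hℓ : ℓ ≠ 0) (c : ℝ) {t : ℝ} (ht : 0 < t) :
    HasDerivAt (fun s : ℝ => (ℓ:ℝ)⁻¹ * c * s ^ (ℓ:ℝ)) (c * t ^ ((ℓ:ℝ) - 1)) t := by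
  have hℓ' : (ℓ:ℝ) ≠ 0 := by exact_mod_cast hℓ
  refine ((Real.hasDerivAt_rpow_const (p := (ℓ:ℝ)) (Or.inl ht.ne')).const_mul
    ((ℓ:ℝ)⁻¹ * c)).congr_deriv ?_
  rw [show (ℓ:ℝ)⁻¹ * c * ((ℓ:ℝ) * t ^ ((ℓ:ℝ) - 1)) = ((ℓ:ℝ)⁻¹ * ℓ) * (c * t ^ ((ℓ:ℝ) - 1)) by ring,
    inv_mul_cancel₀ hℓ', one_mul]

/-- On the closed fibre: `y ↦ ℓ⁻¹ c y^ℓ` is continuous (`0 ≤ ℓ`). [folklore] -/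
theorem intOut_continuous_prim {ℓ : ℚ} (hℓ : 0 < ℓ) (c : ℝ) :
    Continuous fun s : ℝ => (ℓ:ℝ)⁻¹ * c * s ^ (ℓ:ℝ) :=
  continuous_const.mul (Real.continuous_rpow_const (by exact_mod_cast hℓ.le))

/-! ### §4 The stub -/

/-- **Registered stub `stub_integrateOut`** (line `dirichlet-companion-to-pi` of crux
stmt-KontsevichZagierPeriods-13633): integrating out `y^{ℓ-1}` in the last coordinate,
`[(0,1)², x^{m-1}(1-x)^{-m} y^{ℓ-1}] ∼ [(0,1), ℓ⁻¹ x^{m-1}(1-x)^{-m}]`, by ONE Newton–Leibniz move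
(rule (3)) over the base `(0,1)` with constant edges `0 ≤ 1`, band `(0,1) × [0,1]` carrying
`𝟙_{box} · B.integrand`, and primitive `ℓ⁻¹ x^{m-1}(1-x)^{-m} y^ℓ`, followed by dropping the two
null faces of the band (rule (1)). (The hypotheses `0 < m < 1` are not used: both representations
are given, with their convergence.) [cite: KontsevichZagier2001, §1.2 rule (3)] -/
theorem stub_integrateOut : ∀ (ℓ m : ℚ), 0 < ℓ → 0 < m → m < 1 →
    ∀ (B : Literature.NumberTheory.Transcendental.KZ.IntegralRep 2)
      (R : Literature.NumberTheory.Transcendental.KZ.IntegralRep 1),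
    B.domain = {z | z 0 ∈ Set.Ioo (0:ℝ) 1 ∧ z 1 ∈ Set.Ioo (0:ℝ) 1} →
    Set.EqOn B.integrand (fun z => (z 0) ^ ((m:ℝ) - 1) * (1 - z 0) ^ (-(m:ℝ)) *
      (z 1) ^ ((ℓ:ℝ) - 1)) B.domain →
    R.domain = {x | x 0 ∈ Set.Ioo (0:ℝ) 1} →
    Set.EqOn R.integrand (fun x => (ℓ:ℝ)⁻¹ * ((x 0) ^ ((m:ℝ) - 1) * (1 - x 0) ^ (-(m:ℝ)))) R.domain →
    Literature.NumberTheory.Transcendental.KZ.Equivalent B R := by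
  intro ℓ m hℓ _ _ B R hBd hBi hRd hRi
  classical
  have hℓ' : (ℓ:ℝ) ≠ 0 := by exact_mod_cast hℓ.ne'
  -- the band `(0,1) × [0,1] ⊇ box`
  set I : Set (Fin 2 → ℝ) := {z | z 0 ∈ Ioo (0:ℝ) 1 ∧ 0 ≤ z 1 ∧ z 1 ≤ 1} with hI
  have hIs : IsSemialgebraic ℚ I := intOut_isSemialgebraic_band
  have hsub : B.domain ⊆ I := by
    rw [hBd]
    exact fun z hz => ⟨hz.1, hz.2.1.le, hz.2.2.le⟩
  -- the band integrand `𝟙_{box} · B.integrand`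
  set G : (Fin 2 → ℝ) → ℝ := B.domain.indicator B.integrand with hG
  have hGs : IsSemialgebraicFunOn ℚ I G := by
    rw [← union_sdiff_cancel hsub]
    exact IsSemialgebraicFunOn.union B.isSemialgebraicFunOn_integrand
      ((isSemialgebraicFunOn_aeval (hIs.diff B.isSemialgebraic_domain) 0).congr fun x _ => by simp)
      (fun z hz => indicator_of_mem hz _) (fun z hz => indicator_of_notMem hz.2 _)
  have hGi : IntegrableOn G I :=
    ((integrable_indicator_iff (IntegralRep.measurableSet_domain_holds B)).2
      B.integrableOn).integrableOn
  obtain ⟨D, hDd, hDi⟩ : ∃ D : IntegralRep 2, D.domain = I ∧ D.integrand = G :=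
    ⟨⟨I, G, hIs, hGs, hGi⟩, rfl, rfl⟩
  -- ONE Newton–Leibniz move: `[D] − [R] ∈ newtonLeibnizRel`
  have hNL : of D - of R ∈ newtonLeibnizRel := by
    refine ⟨1, D, R, fun _ => (0:ℝ), fun _ => (1:ℝ), fun z : Fin 2 → ℝ =>
        (ℓ:ℝ)⁻¹ * ((z 0) ^ ((m:ℝ) - 1) * (1 - z 0) ^ (-(m:ℝ))) * (z 1) ^ (ℓ:ℝ),
      ?_, ?_, ?_, fun _ _ => zero_le_one, ?_, ?_, ?_, ?_, rfl⟩
    · rw [hDd]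
      exact intOut_isSemialgebraicFunOn_prim hℓ m
    · exact (isSemialgebraicFunOn_aeval R.isSemialgebraic_domain (0 : MvPolynomial (Fin 1) ℚ)).congr
        fun x _ => by simp
    · exact (isSemialgebraicFunOn_aeval R.isSemialgebraic_domain (1 : MvPolynomial (Fin 1) ℚ)).congr
        fun x _ => by simp
    · rw [hDd, hRd, hI]
      ext z
      simp only [mem_setOf_eq, intOut_init_zero, intOut_last_one]
    · intro x _
      simp only [intOut_snoc_zero, intOut_snoc_one]
      exact (intOut_continuous_prim hℓ _).continuousOn
    · intro x hx t ht
      have ht' : t ∈ Ioo (0:ℝ) 1 := ht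
      have hx' : x 0 ∈ Ioo (0:ℝ) 1 := by
        rw [hRd] at hx
        exact hx
      have hmem : (Fin.snoc x t : Fin 2 → ℝ) ∈ B.domain := by
        rw [hBd]
        simp only [mem_setOf_eq, intOut_snoc_zero, intOut_snoc_one]
        exact ⟨hx', ht'⟩
      rw [hDi, hG, indicator_of_mem hmem, hBi hmem]
      simp only [intOut_snoc_zero, intOut_snoc_one]
      exact intOut_hasDerivAt_prim hℓ.ne' _ ht'.1
    · intro x hx
      rw [hRi hx]
      simp only [intOut_snoc_zero, intOut_snoc_one, Real.one_rpow, Real.zero_rpow hℓ', mul_one,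
        mul_zero, sub_zero]
  have hDR : of D - of R ∈ relations := newtonLeibnizRel_subset_relations hNL
  -- drop the two null faces of the band, and match the integrand of `B` on the box
  have hEr : B.domain ⊆ D.domain := by
    rw [hDd]
    exact hsub
  have hvol : volume (D.domain \ B.domain) = 0 := by
    rw [hDd, hI, hBd]
    exact intOut_volume_band_diff_box
  have h1 := D.of_sub_of_restrict_mem_relations B.isSemialgebraic_domain hEr hvol
  have h2 : of (D.restrict B.domain B.isSemialgebraic_domain hEr) - of B ∈ relations := by
    refine of_sub_of_mem_relations_of_eqOn rfl fun z hz => ?_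
    rw [IntegralRep.integrand_restrict, hDi, hG]
    exact indicator_of_mem hz _
  have : of B - of R = (of D - of R) -
      (of D - of (D.restrict B.domain B.isSemialgebraic_domain hEr)) -
      (of (D.restrict B.domain B.isSemialgebraic_domain hEr) - of B) := by
    abel
  show of B - of R ∈ relations
  rw [this]
  exact relations.sub_mem (relations.sub_mem hDR h1) h2

end Summit.KontsevichZagierPeriods.KontsevichZagierPeriods.BetaCancellationLine
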